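import Mathlib
import Summits.Ventures.PercRepro2.HMFRootEdgeNormChordSwap

/-!
# THE ROOT-EDGE CHORD IS A THEOREM: (HMF) and (HCOV) are preserved by adding an edge from `a₃` to
a root (blind cell PercRepro2, night-1 g18; NIGHT1-G18.md §2′)

The two root-edge rows coincide and factor: `ρ₀ = ρ₁ = f₁ · f₂` (`rootTangentZero_eq_mul`,
`rootTangentOne_eq_mul`; a ring identity) with
`f₁ = Z⁰ gap¹ − Z¹ gap⁰` and `f₂ = −Z⁰ (D⁰ J¹ − D_o⁰ (Z¹ − S₃¹)) − Z¹ marginC⁰`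
(`= 2 Z⁰ D⁰ P¹(Q, oH) − Z¹ marginC⁰` at the glued instance).  Both factors are `≤ 0`:

* **`fac1_nonpos`**: gluing `a₃` to `a₁` lowers the conditional gap, `gap¹/Z¹ ≤ gap⁰/Z⁰` — by the
  coupling `P¹(Q, ·) = P⁰(Q, a₃ ∉ C₂, ·)` (`OneEdge.conn_update_true_iff`) and the two BHK
  inequalities for the pair `{a₃ ∈ C₂}`, `{b ∈ C₂}` (same cluster, `bhk_same_cluster_events`) and
  `{a₃ ∈ C₂}`, `{b ∈ C₁}` (cross cluster, `bhk_cross_cluster`);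
* **`fac2_nonpos`**: `2 Z⁰ D⁰ P¹(Q, oH) ≤ Z¹ marginC⁰` — by the coupling and the two cross-cluster
  BHK inequalities (C2) `P(T, oL) D ≤ P(PD, oL) P(T)` and its mirror (`CovForm.ToL_mul_D_le`).

Hence `0 ≤ ρ₀ = ρ₁` (`rootTangent_nonneg`) and, with `HMFRootEdgeNormChord`:

* **`HMF_of_root_edge`** / **`HCov_of_root_edge`**: `HMF (p[f ↦ 0]) → HMF p`,
  `HCov (p[f ↦ 0]) → HCov p` for every edge `f = {a₃, a₁}`, every finite graph, every weight vector
  (`HMF_of_root2_edge` / `HCov_of_root2_edge` for `{a₃, a₂}`).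

Own code; standard axioms.
-/

namespace Summit.Ventures.PercRepro2

open UnionCluster CovForm

namespace RootEdge

section Factor

variable {V : Type*} {E : Type*} [Fintype E] [DecidableEq E] [Fintype V] [DecidableEq V]
  {R : Type*} [Field R] [LinearOrder R] [IsStrictOrderedRing R]

variable (p : E → R) (ends : E → Sym2 V) (o a₁ a₂ a₃ b : V) (f : E)

/-- `f₁ = Z⁰ gap¹ − Z¹ gap⁰`. -/
noncomputable def fac1 : R :=
  prob (Function.update p f 0) (avoidAll ends a₂ {a₁}) * gap (Function.update p f 1) ends a₁ a₂ b -
    prob (Function.update p f 1) (avoidAll ends a₂ {a₁}) * gap (Function.update p f 0) ends a₁ a₂ b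

/-- `f₂ = −Z⁰ (D⁰ J¹ − D_o⁰ (Z¹ − S₃¹)) − Z¹ marginC⁰`, `J = EQo − EQ3o`. -/
noncomputable def fac2 : R :=
  -(prob (Function.update p f 0) (avoidAll ends a₂ {a₁}) *
      (prob (Function.update p f 0) (PDEvent ends a₁ a₂ a₃) *
          (EQo (Function.update p f 1) ends o a₁ a₂ - EQ3o (Function.update p f 1) ends o a₁ a₂ a₃) -
        Do (Function.update p f 0) ends o a₁ a₂ a₃ *
          (prob (Function.update p f 1) (avoidAll ends a₂ {a₁}) -
            EQ3 (Function.update p f 1) ends a₁ a₂ a₃))) -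
    prob (Function.update p f 1) (avoidAll ends a₂ {a₁}) *
      marginC (Function.update p f 0) ends o a₁ a₂ a₃

omit [Fintype V] [DecidableEq V] [LinearOrder R] [IsStrictOrderedRing R] in
/-- **The root rows factor**: `ρ₀ = f₁ · f₂`. -/
theorem rootTangentZero_eq_mul :
    rootTangentZero p ends o a₁ a₂ a₃ b f = fac1 p ends a₁ a₂ b f * fac2 p ends o a₁ a₂ a₃ f := by
  unfold rootTangentZero slope0 core0 core1 fac1 fac2 CovForm.marginC CovForm.DEF
  ring

omit [Fintype V] [DecidableEq V] [LinearOrder R] [IsStrictOrderedRing R] in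
/-- **The root rows coincide**: `ρ₁ = f₁ · f₂`. -/
theorem rootTangentOne_eq_mul :
    rootTangentOne p ends o a₁ a₂ a₃ b f = fac1 p ends a₁ a₂ b f * fac2 p ends o a₁ a₂ a₃ f := by
  unfold rootTangentOne slope1 core0 core1 fac1 fac2 CovForm.marginC CovForm.DEF
  ring

end Factor

section Coupling

variable {V : Type*} {E : Type*} [Fintype E] [DecidableEq E]
  {R : Type*} [Field R] [LinearOrder R] [IsStrictOrderedRing R]

variable (p : E → R) (ends : E → Sym2 V) {a₁ a₂ a₃ : V} {f : E}

omit [LinearOrder R] [IsStrictOrderedRing R] in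
/-- The coupling of `p[f ↦ 1]` and `p[f ↦ 0]`: events matched configuration by configuration have
the same probability. -/
lemma prob_update_one_eq_prob_update_zero_of_iff (A B : Set (Config E))
    (h : ∀ ω, Function.update ω f true ∈ A ↔ Function.update ω f false ∈ B) :
    prob (Function.update p f 1) A = prob (Function.update p f 0) B := by
  rw [prob_eq_expect_indicator, prob_eq_expect_indicator, expect_update_one, expect_update_zero]
  unfold expect
  refine Finset.sum_congr rfl fun ω _ => ?_
  congr 1
  dsimp only
  by_cases hA : Function.update ω f true ∈ A
  · simp only [Set.indicator_of_mem hA, Set.indicator_of_mem ((h ω).1 hA), Pi.one_apply]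
  · rw [Set.indicator_of_notMem hA, Set.indicator_of_notMem (fun hB => hA ((h ω).2 hB))]

/-- The coupling, one direction: `P⁰(B) ≤ P¹(A)` when `B` (with `f` closed) implies `A` (with `f`
open). -/
lemma prob_update_zero_le_prob_update_one_of_imp (hp : IsProbVec p) (A B : Set (Config E))
    (h : ∀ ω, Function.update ω f false ∈ B → Function.update ω f true ∈ A) :
    prob (Function.update p f 0) B ≤ prob (Function.update p f 1) A := by
  rw [prob_eq_expect_indicator, prob_eq_expect_indicator, expect_update_one, expect_update_zero]
  refine expect_mono hp fun ω => ?_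
  by_cases hB : Function.update ω f false ∈ B
  · simp only [Set.indicator_of_mem hB, Set.indicator_of_mem (h ω hB), Pi.one_apply, le_refl]
  · rw [Set.indicator_of_notMem hB]
    exact Set.indicator_nonneg (fun _ _ => zero_le_one) _

omit [Fintype E] [LinearOrder R] [IsStrictOrderedRing R] in
/-- Opening `f = {a₃, a₁}`: `a₂ ↮ a₁` afterwards iff `a₂ ↮ a₁` and `a₂ ↮ a₃` before. -/
lemma Q_update_true_iff (hf : ends f = s(a₃, a₁)) (ω : Config E) :
    Function.update ω f true ∈ avoidAll ends a₂ {a₁} ↔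
      Function.update ω f false ∈ avoidAll ends a₂ {a₁} ∩ (connEvent ends a₂ a₃)ᶜ := by
  have hup : Function.update ω f true = Function.update (Function.update ω f false) f true := by
    rw [Function.update_idem]
  rw [hup]
  simp only [mem_avoidAll, Finset.mem_singleton, forall_eq, Set.mem_inter_iff, Set.mem_compl_iff,
    mem_connEvent, OneEdge.conn_update_true_iff hf]
  constructor
  · intro h
    exact ⟨fun h1 => h (Or.inl h1), fun h3 => h (Or.inr (Or.inl ⟨h3, conn_refl _ _ _⟩))⟩
  · rintro ⟨h1, h3⟩ (h | ⟨h, _⟩ | ⟨h, _⟩)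
    · exact h1 h
    · exact h3 h
    · exact h1 h

omit [Fintype E] [LinearOrder R] [IsStrictOrderedRing R] in
/-- Opening `f = {a₃, a₁}` on `{a₂ ↮ a₁, a₂ ↮ a₃}` does not change the cluster of `a₂`. -/
lemma Q_conn2_update_true_iff (hf : ends f = s(a₃, a₁)) (x : V) (ω : Config E) :
    Function.update ω f true ∈ avoidAll ends a₂ {a₁} ∩ connEvent ends a₂ x ↔
      Function.update ω f false ∈
        avoidAll ends a₂ {a₁} ∩ (connEvent ends a₂ a₃)ᶜ ∩ connEvent ends a₂ x := by
  rw [Set.mem_inter_iff, Q_update_true_iff ends hf ω, Set.mem_inter_iff]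
  have hup : Function.update ω f true = Function.update (Function.update ω f false) f true := by
    rw [Function.update_idem]
  rw [hup]
  simp only [mem_avoidAll, Finset.mem_singleton, forall_eq, Set.mem_inter_iff, Set.mem_compl_iff,
    mem_connEvent, OneEdge.conn_update_true_iff hf]
  constructor
  · rintro ⟨⟨h1, h3⟩, (h | ⟨h, _⟩ | ⟨h, _⟩)⟩
    · exact ⟨⟨h1, h3⟩, h⟩
    · exact absurd h h3
    · exact absurd h h1
  · rintro ⟨⟨h1, h3⟩, h⟩
    exact ⟨⟨h1, h3⟩, Or.inl h⟩

omit [Fintype E] [LinearOrder R] [IsStrictOrderedRing R] in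
/-- Opening `f = {a₃, a₁}` can only enlarge `{a₂ ↮ a₁, a₁ ↔ b}` from `{a₂ ↮ a₁, a₂ ↮ a₃, a₁ ↔ b}`. -/
lemma Q_conn1_update_true_of (hf : ends f = s(a₃, a₁)) (x : V) (ω : Config E)
    (h : Function.update ω f false ∈
      avoidAll ends a₂ {a₁} ∩ (connEvent ends a₂ a₃)ᶜ ∩ connEvent ends a₁ x) :
    Function.update ω f true ∈ avoidAll ends a₂ {a₁} ∩ connEvent ends a₁ x := by
  refine ⟨(Q_update_true_iff ends hf ω).2 h.1, ?_⟩
  have hup : Function.update ω f true = Function.update (Function.update ω f false) f true := by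
    rw [Function.update_idem]
  rw [hup, mem_connEvent, OneEdge.conn_update_true_iff hf]
  exact Or.inl h.2

end Coupling

section Masses

variable {V : Type*} {E : Type*} [Fintype E] [DecidableEq E]
  {R : Type*} [Field R] [LinearOrder R] [IsStrictOrderedRing R]

variable (p : E → R) (ends : E → Sym2 V) (o a₁ a₂ a₃ b : V) {f : E}

omit [Fintype E] [DecidableEq E] [LinearOrder R] [IsStrictOrderedRing R] in
/-- `(Q ∩ X) ∩ {a₂ ↔ a₃} = T ∩ X`. -/
lemma Q_inter_conn23 (X : Set (Config E)) :
    avoidAll ends a₂ {a₁} ∩ X ∩ connEvent ends a₂ a₃ = TEvent ends a₁ a₂ a₃ ∩ X := by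
  ext ω
  simp only [TEvent, mem_avoidAll, Finset.mem_singleton, forall_eq, Set.mem_inter_iff,
    Set.mem_compl_iff, mem_connEvent]
  tauto

omit [LinearOrder R] [IsStrictOrderedRing R] in
/-- `P(Q, a₂ ↮ a₃, X) = P(Q, X) − P(T, X)`. -/
lemma prob_Q_compl23 (X : Set (Config E)) :
    prob p (avoidAll ends a₂ {a₁} ∩ (connEvent ends a₂ a₃)ᶜ ∩ X) =
      prob p (avoidAll ends a₂ {a₁} ∩ X) - prob p (TEvent ends a₁ a₂ a₃ ∩ X) := by
  have h := prob_inter_add_prob_inter_compl p (avoidAll ends a₂ {a₁} ∩ X) (connEvent ends a₂ a₃)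
  rw [Q_inter_conn23, Set.inter_right_comm] at h
  linear_combination h

variable {a₁ a₂ a₃}

omit [LinearOrder R] [IsStrictOrderedRing R] in
/-- `Z¹ = Z⁰ − P⁰(T)` across `f = {a₃, a₁}`. -/
lemma prob_Q_update_one (hf : ends f = s(a₃, a₁)) :
    prob (Function.update p f 1) (avoidAll ends a₂ {a₁}) =
      prob (Function.update p f 0) (avoidAll ends a₂ {a₁}) -
        prob (Function.update p f 0) (TEvent ends a₁ a₂ a₃) := by
  rw [prob_update_one_eq_prob_update_zero_of_iff p _ _ (Q_update_true_iff ends hf)]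
  have h := prob_Q_compl23 (Function.update p f 0) ends a₁ a₂ a₃ Set.univ
  simpa only [Set.inter_univ] using h

omit [LinearOrder R] [IsStrictOrderedRing R] in
/-- `P¹(Q, a₂ ↔ x) = P⁰(Q, a₂ ↔ x) − P⁰(T, a₂ ↔ x)` across `f = {a₃, a₁}`. -/
lemma prob_Q_conn2_update_one (hf : ends f = s(a₃, a₁)) (x : V) :
    prob (Function.update p f 1) (avoidAll ends a₂ {a₁} ∩ connEvent ends a₂ x) =
      prob (Function.update p f 0) (avoidAll ends a₂ {a₁} ∩ connEvent ends a₂ x) -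
        prob (Function.update p f 0) (TEvent ends a₁ a₂ a₃ ∩ connEvent ends a₂ x) := by
  rw [prob_update_one_eq_prob_update_zero_of_iff p _ _ (Q_conn2_update_true_iff ends hf x),
    prob_Q_compl23]

/-- `P⁰(Q, a₁ ↔ x) − P⁰(T, a₁ ↔ x) ≤ P¹(Q, a₁ ↔ x)` across `f = {a₃, a₁}`. -/
lemma prob_Q_conn1_update_one_ge (hp : IsProbVec p) (hf : ends f = s(a₃, a₁)) (x : V) :
    prob (Function.update p f 0) (avoidAll ends a₂ {a₁} ∩ connEvent ends a₁ x) -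
        prob (Function.update p f 0) (TEvent ends a₁ a₂ a₃ ∩ connEvent ends a₁ x) ≤
      prob (Function.update p f 1) (avoidAll ends a₂ {a₁} ∩ connEvent ends a₁ x) := by
  rw [← prob_Q_compl23]
  exact prob_update_zero_le_prob_update_one_of_imp p hp _ _ (Q_conn1_update_true_of ends hf x)

end Masses

section Signs

variable {V : Type*} {E : Type*} [Fintype E] [DecidableEq E] [Fintype V] [DecidableEq V]
  {R : Type*} [Field R] [LinearOrder R] [IsStrictOrderedRing R]

variable (p : E → R) (ends : E → Sym2 V) (o : V) {a₁ a₂ a₃ : V} (b : V) {f : E}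

omit [Fintype E] [DecidableEq E] [Fintype V] [DecidableEq V] [LinearOrder R] [IsStrictOrderedRing R] in
/-- `{a₂ ↔ a₃} ∩ {a₂ ↮ a₁} = T`. -/
lemma conn23_inter_compl : connEvent ends a₂ a₃ ∩ (connEvent ends a₂ a₁)ᶜ = TEvent ends a₁ a₂ a₃ :=
  Set.inter_comm _ _

omit [Fintype E] [DecidableEq E] [Fintype V] [DecidableEq V] [LinearOrder R] [IsStrictOrderedRing R] in
/-- `{a₂ ↔ a₃} ∩ {a₂ ↔ x} ∩ {a₂ ↮ a₁} = T ∩ {a₂ ↔ x}`. -/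
lemma conn23_conn2_inter_compl (x : V) :
    connEvent ends a₂ a₃ ∩ connEvent ends a₂ x ∩ (connEvent ends a₂ a₁)ᶜ =
      TEvent ends a₁ a₂ a₃ ∩ connEvent ends a₂ x := by
  ext ω
  simp only [TEvent, Set.mem_inter_iff, Set.mem_compl_iff, mem_connEvent]
  tauto

omit [Fintype E] [DecidableEq E] [Fintype V] [DecidableEq V] [LinearOrder R] [IsStrictOrderedRing R] in
/-- `{a₂ ↔ a₃} ∩ {a₁ ↔ x} ∩ {a₂ ↮ a₁} = T ∩ {a₁ ↔ x}`. -/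
lemma conn23_conn1_inter_compl (x : V) :
    connEvent ends a₂ a₃ ∩ connEvent ends a₁ x ∩ (connEvent ends a₂ a₁)ᶜ =
      TEvent ends a₁ a₂ a₃ ∩ connEvent ends a₁ x := by
  ext ω
  simp only [TEvent, Set.mem_inter_iff, Set.mem_compl_iff, mem_connEvent]
  tauto

omit [Fintype E] [DecidableEq E] [Fintype V] [DecidableEq V] [LinearOrder R] [IsStrictOrderedRing R] in
/-- `{s ↔ x} ∩ {a₂ ↮ a₁} = Q ∩ {s ↔ x}`. -/
lemma conn_inter_compl (s x : V) :
    connEvent ends s x ∩ (connEvent ends a₂ a₁)ᶜ = avoidAll ends a₂ {a₁} ∩ connEvent ends s x := by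
  ext ω
  simp only [mem_avoidAll, Finset.mem_singleton, forall_eq, Set.mem_inter_iff, Set.mem_compl_iff,
    mem_connEvent]
  tauto

omit [Fintype E] [DecidableEq E] [Fintype V] [DecidableEq V] [LinearOrder R] [IsStrictOrderedRing R] in
/-- `{a₂ ↮ a₁} = Q`. -/
lemma compl_eq_Q : (connEvent ends a₂ a₁)ᶜ = avoidAll ends a₂ {a₁} := by
  ext ω
  simp only [mem_avoidAll, Finset.mem_singleton, forall_eq, Set.mem_compl_iff, mem_connEvent]

/-- **Same-cluster BHK for `{a₃ ∈ C₂}`, `{b ∈ C₂}`**: `P(T) P(Q, bH) ≤ P(Q) P(T, bH)`. -/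
lemma T_mul_QbH_le (hp : IsProbVec p) :
    prob p (TEvent ends a₁ a₂ a₃) * prob p (avoidAll ends a₂ {a₁} ∩ connEvent ends a₂ b) ≤
      prob p (avoidAll ends a₂ {a₁}) * prob p (TEvent ends a₁ a₂ a₃ ∩ connEvent ends a₂ b) := by
  have h := bhk_same_cluster_events p hp ends a₂ a₁ (𝓤 := {W : Set V | a₃ ∈ W})
    (𝓥 := {W : Set V | b ∈ W}) (fun _ _ hle h => hle h) (fun _ _ hle h => hle h)
  rw [← connEvent_eq_clusterInEvent ends a₂ a₃, ← connEvent_eq_clusterInEvent ends a₂ b,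
    conn23_inter_compl, conn23_conn2_inter_compl, conn_inter_compl, compl_eq_Q] at h
  linarith [h]

/-- **Cross-cluster BHK for `{a₃ ∈ C₂}`, `{b ∈ C₁}`**: `P(Q) P(T, bL) ≤ P(T) P(Q, bL)`. -/
lemma Q_mul_TbL_le (hp : IsProbVec p) :
    prob p (avoidAll ends a₂ {a₁}) * prob p (TEvent ends a₁ a₂ a₃ ∩ connEvent ends a₁ b) ≤
      prob p (TEvent ends a₁ a₂ a₃) * prob p (avoidAll ends a₂ {a₁} ∩ connEvent ends a₁ b) := by
  have h := bhk_cross_cluster p hp ends a₂ a₁ (𝓤 := {W : Set V | a₃ ∈ W})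
    (𝓥 := {W : Set V | b ∈ W}) (fun _ _ hle h => hle h) (fun _ _ hle h => hle h)
  rw [← connEvent_eq_clusterInEvent ends a₂ a₃, ← connEvent_eq_clusterInEvent ends a₁ b,
    conn23_conn1_inter_compl, conn23_inter_compl, conn_inter_compl, compl_eq_Q] at h
  linarith [h]

/-- **`f₁ ≤ 0`**: gluing `a₃` to `a₁` lowers the conditional gap. -/
theorem fac1_nonpos (hp : IsProbVec p) (hf : ends f = s(a₃, a₁)) :
    fac1 p ends a₁ a₂ b f ≤ 0 := by
  have hp0 : IsProbVec (Function.update p f 0) := hp.update f le_rfl zero_le_one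
  have hp1 : IsProbVec (Function.update p f 1) := hp.update f zero_le_one le_rfl
  unfold fac1
  rw [CovForm.gap_eq_Q (Function.update p f 1) ends a₁ a₂ b,
    CovForm.gap_eq_Q (Function.update p f 0) ends a₁ a₂ b,
    prob_Q_conn2_update_one p ends hf b, prob_Q_update_one p ends hf]
  have hbL := prob_Q_conn1_update_one_ge p ends (a₂ := a₂) hp hf b
  have hZ0 : 0 ≤ prob (Function.update p f 0) (avoidAll ends a₂ {a₁}) := prob_nonneg hp0 _
  have h1 := T_mul_QbH_le (Function.update p f 0) ends b hp0 (a₁ := a₁) (a₂ := a₂) (a₃ := a₃)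
  have h2 := Q_mul_TbL_le (Function.update p f 0) ends b hp0 (a₁ := a₁) (a₂ := a₂) (a₃ := a₃)
  have h3 := mul_le_mul_of_nonneg_left hbL hZ0
  nlinarith [h1, h2, h3]

/-- **`f₂ ≤ 0`**: `2 Z⁰ D⁰ P¹(Q, oH) ≤ Z¹ marginC⁰` — the two cross-cluster (C2) inequalities. -/
theorem fac2_nonpos (hp : IsProbVec p) (hf : ends f = s(a₃, a₁)) :
    fac2 p ends o a₁ a₂ a₃ f ≤ 0 := by
  have hp0 : IsProbVec (Function.update p f 0) := hp.update f le_rfl zero_le_one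
  have h1 : (Function.update p f 1) f = 1 := by simp
  unfold fac2
  rw [EQ3_of_sure (Function.update p f 1) ends a₁ a₂ a₃ hf h1,
    EQ3o_of_sure (Function.update p f 1) ends o a₁ a₂ a₃ hf h1]
  unfold CovForm.EQo
  rw [prob_Q_conn2_update_one p ends hf o, prob_Q_update_one p ends hf,
    CovForm.margin_identity, CovForm.Qsplit (Function.update p f 0) ends a₁ a₂ a₃ (connEvent ends a₂ o),
    CovForm.Qsplit_univ (Function.update p f 0) ends a₁ a₂ a₃]
  unfold CovForm.Do
  -- the (C2) inequalities in the instance without the edge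
  have hC2 := CovForm.ToL_mul_D_le (Function.update p f 0) hp0 ends o a₁ a₂ a₃
  have hC2' := CovForm.ToL_mul_D_le (Function.update p f 0) hp0 ends o a₂ a₁ a₃
  rw [PDEvent_root_swap] at hC2'
  have hD := prob_nonneg hp0 (PDEvent ends a₁ a₂ a₃)
  have hT := prob_nonneg hp0 (TEvent ends a₁ a₂ a₃)
  have hT' := prob_nonneg hp0 (TEvent ends a₂ a₁ a₃)
  have hDoL := prob_nonneg hp0 (PDEvent ends a₁ a₂ a₃ ∩ connEvent ends a₁ o)
  have hDoH := prob_nonneg hp0 (PDEvent ends a₁ a₂ a₃ ∩ connEvent ends a₂ o)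
  have hToL := prob_nonneg hp0 (TEvent ends a₁ a₂ a₃ ∩ connEvent ends a₁ o)
  have hToH := prob_nonneg hp0 (TEvent ends a₁ a₂ a₃ ∩ connEvent ends a₂ o)
  have hT'oH := prob_nonneg hp0 (TEvent ends a₂ a₁ a₃ ∩ connEvent ends a₂ o)
  nlinarith [mul_nonneg hT (sub_nonneg.2 hC2'), mul_nonneg (add_nonneg hD hT') (sub_nonneg.2 hC2),
    mul_nonneg hD hT, mul_nonneg hD hT', mul_nonneg hT hT', mul_nonneg hD hDoH, mul_nonneg hT hToH,
    mul_nonneg hD hT'oH]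

/-- **The root rows are nonnegative**: `0 ≤ ρ₀ = ρ₁ = f₁ f₂`. -/
theorem rootTangent_nonneg (hp : IsProbVec p) (hf : ends f = s(a₃, a₁)) :
    0 ≤ rootTangentZero p ends o a₁ a₂ a₃ b f ∧ 0 ≤ rootTangentOne p ends o a₁ a₂ a₃ b f := by
  have h1 := fac1_nonpos p ends (a₂ := a₂) b hp hf
  have h2 := fac2_nonpos p ends o (a₂ := a₂) hp hf
  have h := mul_nonneg (neg_nonneg.2 h1) (neg_nonneg.2 h2)
  rw [neg_mul_neg] at h
  rw [rootTangentZero_eq_mul, rootTangentOne_eq_mul]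
  exact ⟨h, h⟩

/-- **(HMF) is preserved by adding an edge from `a₃` to the root `a₁`**:
`HMF (p[f ↦ 0]) → HMF p` for every edge `f = {a₃, a₁}`. -/
theorem HMF_of_root_edge (hp : IsProbVec p) (hf : ends f = s(a₃, a₁))
    (hHMF : HMF (Function.update p f 0) ends o a₁ a₂ a₃ b) : HMF p ends o a₁ a₂ a₃ b :=
  HMF_of_root_edge_of_tangents p ends o b hp hf (rootTangent_nonneg p ends o b hp hf).1
    (rootTangent_nonneg p ends o b hp hf).2 hHMF

/-- **(HCOV) is preserved by adding an edge from `a₃` to the root `a₁`**: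
`HCov (p[f ↦ 0]) → HCov p` for every edge `f = {a₃, a₁}`. -/
theorem HCov_of_root_edge (hp : IsProbVec p) (hf : ends f = s(a₃, a₁))
    (hHCov : HCov (Function.update p f 0) ends o a₁ a₂ a₃ b) : HCov p ends o a₁ a₂ a₃ b :=
  HCov_of_root_edge_of_tangents p ends o b hp hf (rootTangent_nonneg p ends o b hp hf).1
    (rootTangent_nonneg p ends o b hp hf).2 hHCov

/-- **(HMF) is preserved by adding an edge from `a₃` to the root `a₂`.** -/
theorem HMF_of_root2_edge (hp : IsProbVec p) (hf : ends f = s(a₃, a₂))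
    (hHMF : HMF (Function.update p f 0) ends o a₁ a₂ a₃ b) : HMF p ends o a₁ a₂ a₃ b :=
  HMF_of_root2_edge_of_tangents p ends o b hp hf (rootTangent_nonneg p ends o b hp hf).1
    (rootTangent_nonneg p ends o b hp hf).2 hHMF

/-- **(HCOV) is preserved by adding an edge from `a₃` to the root `a₂`.** -/
theorem HCov_of_root2_edge (hp : IsProbVec p) (hf : ends f = s(a₃, a₂))
    (hHCov : HCov (Function.update p f 0) ends o a₁ a₂ a₃ b) : HCov p ends o a₁ a₂ a₃ b :=
  HCov_of_root2_edge_of_tangents p ends o b hp hf (rootTangent_nonneg p ends o b hp hf).1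
    (rootTangent_nonneg p ends o b hp hf).2 hHCov

end Signs

end RootEdge

end Summit.Ventures.PercRepro2
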